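import Literature.MathematicalPhysics.QuantumFieldTheory.Balaban1983to89.B6Ineq2133TwoScaleV1
import Literature.MathematicalPhysics.QuantumFieldTheory.Balaban1983to89.B6Geom246MultiLevelTorusL0
import Literature.MathematicalPhysics.QuantumFieldTheory.Balaban1983to89.B6Ineq2134ThetaKLevelL0
import Literature.MathematicalPhysics.QuantumFieldTheory.Balaban1983to89.B6Geom246MultiLevelBoxL0
import Literature.MathematicalPhysics.QuantumFieldTheory.Balaban1983to89.B6Ineq288MultiLevelBoxL0
import Literature.MathematicalPhysics.QuantumFieldTheory.Balaban1983to89.B6MultiLevelBoxOperatorL0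
import Literature.MathematicalPhysics.QuantumFieldTheory.Balaban1983to89.B6MultiLevelTorusOperatorL0
import Literature.MathematicalPhysics.QuantumFieldTheory.Balaban1983to89.B6Prop22KLevelCensusEtaL0
import Literature.MathematicalPhysics.QuantumFieldTheory.Balaban1983to89.B6Prop22KLevelCensusL0
import Literature.MathematicalPhysics.QuantumFieldTheory.Balaban1983to89.B6Prop26ReachTransplant
/-!
# `Balaban1983to89.B6Prop26ReachTransplantL0` — LEVEL-0 TWIN (programme G-F3′-L0, director-ym LINE №27 / UV3-NODE §24.5; plan `lit-balaban-r03/G-F3L0-PLAN.md`) of `B6Prop26ReachTransplant`: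
the same declarations, SAME NAMES AND STATEMENTS, for nested families WITH print's region `Λ₀ = T ∖ Ω₁` ADMITTED (structures
`B6MultiLevelBoxOperatorL0.Domains` / `B6MultiLevelTorusOperatorL0.TDomains`: levels `0, …, k`, the level-`0` block a single site, `Q′₀ = id`,
finite weight `a₀` — print p.225 (2.14) «Σ_{j=0}^k … (Q′₀λ)(x) = λ(x), x ∈ Λ₀», p.229 «taking a sequence (2.1) … smallest possible domains B^j(Λ_j),
and considering the operator Δ_a defined by (2.19), (2.20) for this sequence»).  Every `D`-free object is the lineage's, consumed BY NAME; no existing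
module is touched; no fact is minted.  Unit `lit-balaban-r03` (B6 fold owner, r03 gen 36); referee ref-4.  THE TWIN'S DOCUMENTATION FOLLOWS
VERBATIM (its «levels 1 … k» / «Ω₁ = X» sentences describe the twin; here `j` runs from `0` and `Ω₁` may be a proper subset).

# `Balaban1983to89.B6Prop26ReachTransplant` — T. Bałaban, *Propagators and renormalization transformations for lattice gauge theories. II*,
# Commun. Math. Phys. **96** (1984) 223–250 [Balaban1984PropagatorsII]: THE GEOMETRY BRIDGE OF PROPOSITION 2.6 — the local operators `G_□`
# of (2.90), living on their own tori `T_□`, READ ON THE GLOBAL LATTICE through the window `□̃³ ⊂ T_η`, and the inequality (2.133) (decay in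
# the torus distance of the `j`-blocks of `T_□`) TRANSPORTED to the `h2133`-shaped local majorant in the multiscale distance `d` of (2.46) that
# the gluing `B6Prop26Gluing.prop26_2136_of_2133_2134_lemma21` consumes; FIRED on the genuine nested box family (`B6Geom246MultiLevelBox`) and
# on the torus family `T_η` (`B6Geom246MultiLevelTorus`) with every geometric input discharged (no existing module is touched; no fact is minted)

statement-level skeleton of published theorems with citation tags; proofs where landed; nothing here is a claim about the Yang–Mills mass gap

PDF held: `paper:balaban1984-cmp96-propagators-rt-ii` (journal page = PDF page + 222); pp. 238–239 [PDF 16–17], p. 247 [PDF 25], p. 231 [PDF 9],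
p. 224 [PDF 2] re-read as page renders (`run/shared/lean/pub/pub-balaban/b2b-balaban-ref1/pages/1984-cmp96-propagators-rt-II/…-p002/p007/p016/
p017/p025-x2.png`) this generation.  Unit `lit-balaban-r03` (B6 fold owner, Phase-2 own lane; r03 gen 18, literature-prover-lit-balaban-r03-g18-0),
HOME `run/shared/lean/pub/lit-balaban/`; B6-CLOSURE.md §5 item 6 **(c)** («THE GEOMETRY BRIDGE», owner's design step after p38's bite (a)
`B6Ineq2133TwoScaleV1` p340300); referee ref-4.  SKELETON rows **B6.Eq2.133** × **B6.Prop2.6** × **B6.Eq2.89** (cells; decls of record untouched).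

## WHAT IS PRINTED (verbatim up to notation)

p. 238–239: *"Let us take a cube □ connected with a L^jη-scale, i.e. either □ ⊂ B^j(Λ_j), or it intersects also B^{j+1}(Λ_{j+1}). A cube □̃ is
obtained from □ by taking a sum of 4^d big blocks … In the same way a cube □̃² is formed … next a cube □̃³, and so on. We take the cube □̃³ and
identify it with a torus, denoted by T_□, imposing periodicity conditions. On this torus we define operators R, Δ_a as in (2.17), (2.19), but only
two scales are present now. … G_□ = (Δ − ∂P_□∂* + Q*aQ)⁻¹. (2.90)  Both operators are defined on the torus T_□. We form an approximation of G
taking as usual G₀ = Σ_{□∈𝒟} h_□G_□h_□."*  p. 247: *"|(G_□J)(x)|, |(∇G_□J)(x)| ≤ O(1)[(L^jη)², L^jη]e^{−δ₂(L^jη)^{−1}dist(Δ,Δ′)}|J|, (2.133) for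
x ∈ Δ(y), supp J ⊂ Δ(y′), y, y′ ∈ 𝔅 ∩ T_□. Applying the inequalities (2.133), (2.88) and the remarks after the inequality (2.68) we obtain
|(K_{□,□′}G_{□′}h_{□′}J)(x)| ≤ O(M^{−1})e^{−½δ₂d(y,y′)}|J| (2.134)"*.  p. 231: *"d(x, x′) = d(y, y′) if x ∈ B^j(y), x′ ∈ B^{j′}(y′)."*

The words *"identify it with a torus"* and *"G₀ = Σ h_□G_□h_□"* hide a change of lattice: `G_□` acts on the bond functions of ITS OWN torus
`T_□`, `h_□` on those of `T_η`; and between (2.133) (decay in the scaled euclidean distance of `T_□`) and (2.134) (decay in the multiscale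
distance `d` of the global block lattice `𝔅`) stands the comparison of the two distances inside the reach of one box — displayed nowhere in print
(cell GAPS G-pv08-1, G-pv01-5 (i): «(2.133) enters already in d-form» in `B6Prop26Gluing`).  In the tree: the two-scale `G_□` and its
(1.110)–(1.114) live on the V1 torus carriers `Site P j` (p22/p38/r03: `B6SectCTwoScaleV1`, `B6Prop25TwoScaleCensus.TSIdx`, `B6Ineq2133TwoScaleV1`),
the global multi-level block lattice `𝔅`, (2.46) and Lemma 2.1 on p21's box/torus carriers `↥(boxDom N₀)` (`B6Geom246MultiLevelBoxL0.geom`,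
`B6Geom246MultiLevelTorusL0.geomT`).  THIS FILE is the dictionary between the two.

## WHAT THIS FILE CERTIFIES (kernel-checked, sorry-free, standard axioms)

* §1 **TRANSPLANT ALONG A PARTIAL CHART** (any lattices `X` ⊇ window `W` —`e`→ `X′`): `restrictOp` (`ρ`: read a global function on `T_□`,
  zero off `e(W)`), `extendOp` (`ε`: extend by zero), **`transplant W e T′ = ε ∘ T′ ∘ ρ`** — the operator meant by `G_□` inside `h_□G_□h_□`;
  evaluation lemmas; **`localMajorant_transplant`**: a majorant `K′` of `T′` with respect to the local block map (`B6RandomWalk.HasMajorant`), an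
  `e`-injective window, a pointwise comparison `K′(blk′(e x), blk′(e x₁)) ≤ K(blk x, blk x₁)` over the reach `S` and «every global block of `S` is
  charted into `≤ n` local blocks» give `B6Prop26Gluing.LocalMajorant blk (transplant W e T′) S (n·K)` (the source in one global block is cut into
  its `≤ n` local block pieces `B6RandomWalk.blockPiece`, each bounded by the local majorant).
* §2 `expKernel_le_of_dist_le`: `d ≤ κt + c₀ ⟹ A·e^{−δt} ≤ A·e^{δc₀/κ}·e^{−(δ/κ)d}`.
* §3 **THE LOCAL SIDE** for a member `i : TSIdx` (torus `T_□ = Site i.P 0`, `2L^{m+K}` sites per direction, scales `j, j+1`): the chart of a cube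
  `siteOfInt` (`val_siteOfInt`), **blocks ↦ blocks** `rep_iterBlockOf_siteOfInt` (the `j`-block of the charted point has labels `⌊z_μ/L^j⌋`, V1's
  `val_iterBlockOf`), and **`supNorm_sub_le_tdist`**: for two points of a window of side `≤ L^{m+K}` (half the fine period — no pair of charted
  blocks is closer across the torus than inside the window, `torusSupNorm_of_centred`), `|z − z₁|_∞ ≤ L^j·|y(z) − y(z₁)|_T + (L^j − 1)` with
  r03's `TSIdx.tdist` (the distance of p38's majorant).
* §4 **THE BRIDGE** `localMajorant_transplant_of_window`: for ANY global block geometry `g` with integer bond coordinates `pos`/`dir`, a window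
  `InWindow pos x₀ W` (`W ≤ L^{m+K}`), the bond chart `chartBond` (injective on the window, `injOn_chartBond`), a local operator `T′` with majorant
  `A·e^{−δ|y−y′|_T}` on the `j`-blocks of `T_□`, the comparison `d(blk x, blk x₁) ≤ κ·|pos x − pos x₁|_∞/L^j + c` on the window and the fibre
  count `n`: `LocalMajorant blk (transplant … T′) S (n·A·e^{δ(κ+c)/κ}·e^{−(δ/κ)d})`; **`reach2133_G` / `reach2133_DG`**: p38's
  `ineq2133_G`/`ineq2133_DG` (ONE `δ₂ > 0`, ONE `A ≥ 0` on `d, L, a₀, a₁`, before everything) through the bridge, for `G_□` and every `∇_λG_□`.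
* §5 **FIRED ON THE GENUINE NESTED BOX FAMILY** `D : B6MultiLevelBoxOperatorL0.Domains` (global bonds `BoxBond` = (box site, direction), block map
  `blkBond D b = y(b₋)`): `hglob_box` — the comparison with `κ = c = d+1` IS p21's `dist_blkOf_le_box` (windows are coordinatewise convex);
  `hfib_box` — over a block of level `j` or `j+1` meeting a window with corner `x₀ ∈ L^jℤ^{d+1}` there are `≤ L^{d+1}` charted `j`-blocks (a block
  of level `j+1` IS a cube of `L^{d+1}` blocks of level `j`; `coord_bounds`, `rep` injective); **`reach2133_G_box` / `reach2133_DG_box`**: for every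
  member `G_□`, every `D` (`M_h ≥ 1`, `P_μ ≥ 1`), every window all of whose box sites have level `j` or `j+1`, every finite set `W` of window bonds
  and every reach `S ⊂ 𝔅`, `LocalMajorant (g := geom D) (blkBond D) (transplant W (chartBond …) (onFun G_□)) S
  (L^{d+1}·A·e^{2δ₂}·e^{−(δ₂/(d+1))·d(y,y′)})` — LITERALLY the hypothesis `h2133` of `B6Prop26Gluing.prop26_2136_of_2133_2134_lemma21` (with
  `P ≡ 1`) for `Gl □ := transplant … (onFun G_□)`.
* §6 **THE SAME ON `T_η`** (p21's `TDomains`, `geomT`, bonds across the torus): `hglob_torus` (`distT_le_dist_box`), **`reach2133_G_torus`** for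
  windows of the fundamental box.
* §7 (**v1.1**, append-only; r03 gen 18 after p38 gen 24's `B6Ineq2134ThetaKLevel` p341566 fixed the carriers of the (2.134) files) **THE SAME ON
  p38's CARRIERS, IN PRINT'S UNITS**: member `i : KIdx d ℓ`, geometry `geoB i` (`geoB_dist` = p21's (2.46), `geoB_len y = L^{j(y)}η`, `η = L^{−k}`),
  bonds `XV i = Fin (d+1) × ↥i.XB`, block map `blkV i`; generic inputs `hglob_sites`/`hfib_sites` (any lattice over the box sites),
  `localMajorant_smul_of_le`; the operators **`GlEta t i W x₀ := (L^jη)² • transplant W (chartBond t …) (onFun G_□)`** and `DGlEta` (`(L^jη) • …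
  (onFun (∇_λ ∘ G_□))`) — (2.94) *"G^η_□(L^jηb, L^jηb′) = (L^jη)^{−d+2}G^ξ_□(b, b′) … and correspondingly for derivatives of G_□"* read for the
  operators; **`reach2133_G_geoB`**: `∃ δ_G > 0, C_G ≥ 0 ∀ t i x₀ … W S, (∀ a ∈ S, j ≤ level a) → LocalMajorant (g := geoB i) (blkV i) (GlEta t i W x₀) S
  (fun y″ y′ => C_G * (geoB i).len y″ ^ 2 * e^{−δ_G d(y″,y′)})` — LITERALLY the hypothesis `hG` of `B6Ineq2134ThetaKLevelL0.ineq2134_kOff_kLevel`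
  (`C_G = L^{d+1}·A·e^{2δ₂}`, `δ_G = δ₂/(d+1)`); `reach2133_DG_geoB` (weight `len y″`, every direction).
* §8 (**v1.2**, append-only; asked by p38 gen 25 for (b′)) LOCALISATION: `outLoc_transplant` / `inLoc_transplant` (the transplant writes only on, and
  reads only from, the blocks met by the window — `B6Prop26Gluing.OutLoc`/`InLoc`), `outLoc_GlEta`, `outLoc_DGlEta`, `inLoc_GlEta` (the `hGout`-type
  hypotheses of `B6Ineq2134Diag.diag_hasMajorant` / `hKout` of the gluing for the transplanted operators).
* §9 (**v1.3**, append-only; B6-CLOSURE §5 item 7 (d3)) **THE BIJECTIVE WINDOW `□̃³ = T_□`** (p. 238 *"We take the cube □̃³ and identify it with a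
  torus, denoted by T_□, imposing periodicity conditions"*): `restrictOp_extendOp_of_bij` (`ρ∘ε = 1` for a bijective chart), **`transplant_mul_of_bij`**
  (the transplant through a bijective window is MULTIPLICATIVE), `transplant_sub`/`_add`/`_smul`, `transplant_one_mul_mulOp`,
  **`transplant_inv_mul_mulOp(_smul)`** / **`hinv_of_bij`**: `D_□G_□ = 1` on `T_□` ⟹ `(c•εM_□ρ − c•εP_□ρ)·(c⁻¹•εG_□ρ)·h_□ = h_□` for `h_□` supported
  in the window — LITERALLY the inversion hypothesis `hinv` of `B6Eq291Generator.eq291` / `hinvl` of `B6GlobalChartV1L0.prop26_2136_V1_of_2134_eq291`;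
  §9b `siteOfInt_val`, **`injOn_chartBond_full`** (injective on any window of side `≤ 2L^{m+K}`), **`surj_chartBond_full`** (a full window is ONTO
  the bonds of `T_□`); §9c `supNorm_sub_le_tdist_shift` (torus distance = flat distance on a half-period sub-window ANYWHERE in the fundamental
  domain, corner in `L^jℤ^{d+1}`), **`localMajorant_transplant_of_window₂`** and **`reach2133_G₂`/`reach2133_DG₂`**: v1's bridge and (2.133) with
  the window enlarged up to the full period (so that the chart may be the bijection `□̃³ = T_□`) and the reach `S` confined to a half-period
  sub-window — same constants.

## HONEST SCOPE / DIVERGENCES (nothing is inferred from the manuscript; every step is kernel-checked)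

(1) `T_□`: print identifies the cube `□̃³` (side `8M` big-block units) itself with a torus; the two-scale members of the tree live on V1 tori of
side `2L^{m′+K′}` fine sites (`B6Prop25TwoScaleCensus.TSIdx`, all periods equal), so `T_□` here is ANY member torus at least twice as wide as the
charted window (hypothesis `W ≤ L^{m′+K′}`) — a torus possibly LARGER than `□̃³` carrying the copy of the window; the decay constants of
`B6Ineq2133TwoScaleV1` are uniform in the member, so nothing depends on this size, but the member whose `Λ′ ⊂ T^{(j+1)}` matches the level-`(j+1)`
part of the window ((2.89) `B^j(Λ) = □̃² ∩ B^{j+1}(Λ_{j+1})`) is CHOSEN BY THE CONSUMER (this file quantifies over all members and all windows;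
it does not construct the cover `𝒟` nor the partition `h_□` — p21's `B6Cover236MultiLevelBlocks` / `B6Eq238MultiLevelTorusL0.cubeSetT` — nor the
identity (2.91), B6-CLOSURE §5 item 6 (b)/(d)).  (2) The window is a lattice cube of levels `j, j+1` only («connected with the L^jη-scale»; a cube
meeting the level `j − 1` is charted at scale `j − 1`, p21's `js □`), corner in `L^jℤ^{d+1}`; blocks are charted to blocks because both lineages
label blocks by `⌊x_μ/L^j⌋` (corner convention).  (3) Rates and constants: print passes from `δ₂` in (2.133) to `½δ₂` in (2.134); here the rate
becomes `δ₂/(d+1)` and the constant `L^{d+1}·A·e^{2δ₂}` (the `(d+1)` of p21's `ℓ¹`-walk comparison `dist_blkOf_le_box`, the `L^{d+1}` of the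
level-`(j+1)` blocks of the window, `e^{2δ₂}` from the additive slack `|Δ − Δ′|` vs `|y − y′|`); all depend on `d, L, a₀, a₁` only, as print's
«O(1)», «δ₂(d, L)».  (4) Units: `L^jη = 1` (the `ξ`-lattice units of `T_□`, as in `B6Ineq2133TwoScaleV1`; the `η`-rescaling (2.94) is
`B6Eq294Scaling`), so the weight `P` of `h2133` is `≡ 1`.  (5) The global lattice is p21's fine box / fundamental domain of `T_η` with bonds =
(site, direction) pairs; windows wrapping around `T_η` are not treated here (they go through the translation charts `B6MultiLevelTorusOperatorL0.TDomains.chart` /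
`distT_le_dist_chart` of `B6Geom246MultiLevelTorus`, one chart per cube as in `B6Eq238MultiLevelTorus`).  (6) `instDecidableEqPBond`: decidable
equality of V1 bonds (a structure of two decidable fields), registered here because the tree has none.  (7) v1.1, units: `GlEta`/`DGlEta` carry the
factors `(L^jη)²` / `L^jη` of (2.94) with `η = L^{−k}` of the GLOBAL member (`B6Prop22KLevelCensusEtaL0.nK`), i.e. they are `G_□`, `∇G_□` in print's
`η`-units PROVIDED the global operators of the consumer are in print's units too (as `geoB`/`gpP` are); in the LATTICE units of p21's `mlOp` the
factor would be `L^{2j}` — the consumer of (2.91) decides, this file proves the majorant for the `η`-unit reading and (§5) for the unscaled one.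
(8) v1.3, the size of `T_□`: print's `T_□` IS `□̃³` (side `7·M` in `L^jη`-units, periodised); a V1 member torus has side `2L^{m′+K′}`, which is
never `7M` — so under §9 the fundamental domain of the member (side `2L^{m′+K′} ≥` side of `□̃³`, containing `□̃³`, two-level by (2.2) when
`R·M ≥ 2L^{m′+K′}`) plays the role of `□̃³`: a DECLARED MODEL READING («a torus containing □̃³» instead of «□̃³ itself»); the operators, (2.90), (2.91)
and every estimate are print's, the torus is larger.  No `def … : Prop`, no new hypothesis-shaped
fact; value = typed skeleton + a located gap CLOSED at the geometry level, NOT summit progress.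
-/

noncomputable section

open scoped BigOperators
open Finset

namespace Literature.MathematicalPhysics.QuantumFieldTheory.Balaban1983to89.B6Prop26ReachTransplantL0

open B6RandomWalk (HasMajorant BlockSupp blockPiece sum_blockPiece blockSupp_blockPiece)
open B6Prop26Gluing (LocalMajorant mulOp mulOp_apply)
open Literature.MathematicalPhysics.QuantumFieldTheory.Balaban1983to89.B6Prop26ReachTransplant (restrictOp extendOp transplant restrictOp_apply restrictOp_apply_of_injOn restrictOp_apply_of_not_mem extendOp_apply transplant_apply restrictOp_extendOp_apply localMajorant_transplant expKernel_le_of_dist_le siteOfInt sitesPerDir_zero sitesPerDir_j val_siteOfInt rep_iterBlockOf_siteOfInt supNorm_sub_le_tdist instDecidableEqPBond chartBond chartBond_src InWindow injOn_chartBond localMajorant_transplant_of_window reach2133_G reach2133_DG BoxBond localMajorant_smul_of_le outLoc_transplant inLoc_transplant restrictOp_extendOp_of_bij transplant_mul_of_bij transplant_sub transplant_add transplant_smul transplant_one_mul_mulOp transplant_inv_mul_mulOp transplant_inv_mul_mulOp_smul hinv_of_bij siteOfInt_val injOn_chartBond_full surj_chartBond_full supNorm_sub_le_tdist_shift localMajorant_transplant_of_window₂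 reach2133_G₂ reach2133_DG₂)

/-! ## §1  Transplanting an operator of a local lattice `X′` to the global lattice `X` along a partial chart -/

section Transplant

variable {X X' : Type} [DecidableEq X'] (W : Finset X) (e : X → X')

variable {W e}

/-- for an injective chart, `(ρf)(x′)` is a value of `f` on the window or `0`. [folklore] -/
private theorem restrictOp_eq_or (hinj : Set.InjOn e ↑W) (f : X → ℝ) (x' : X') :
    (∃ x ∈ W, e x = x' ∧ restrictOp W e f x' = f x) ∨ restrictOp W e f x' = 0 := by
  by_cases h : ∃ x ∈ W, e x = x'
  · obtain ⟨x, hx, rfl⟩ := h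
    exact Or.inl ⟨x, hx, rfl, restrictOp_apply_of_injOn hinj f hx⟩
  · exact Or.inr (restrictOp_apply_of_not_mem f fun x hx hex => h ⟨x, hx, hex⟩)

variable [DecidableEq X]

end Transplant

/-! ## §2  Exponential majorants: a comparison of distances is a comparison of kernels -/

section LocalTorus

open B5Eq118OneStroke (iterBlockOf val_iterBlockOf)
open B6LowerBound2153Torus (rep)
open B5Eq117TorusCarriers (Mk)
open B4ContourShift (supNorm abs_le_supNorm supNorm_nonneg)
open B4TorusKernel.MultiPeriod (torusSupNorm torusSupNorm_of_centred)
open B6Prop25TwoScaleCensus (TSIdx)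

variable {d L : ℕ} {hd : 1 ≤ d + 1} {hL : Odd L ∧ 1 < L} {a₀ a₁ : ℝ} (i : TSIdx d L hd hL a₀ a₁)

/-- floor division by `n > 0` is `n`-Lipschitz up to the remainder: `|a − b| ≤ n·|⌊a/n⌋ − ⌊b/n⌋| + (n − 1)`. [folklore] -/
private theorem abs_sub_le_mul_abs_ediv_sub (n : ℤ) (hn : 0 < n) (a b : ℤ) : |a - b| ≤ n * |a / n - b / n| + (n - 1) := by
  have ha := Int.emod_def a n
  have hb := Int.emod_def b n
  have hra0 := Int.emod_nonneg a hn.ne'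
  have hrb0 := Int.emod_nonneg b hn.ne'
  have hra := Int.emod_lt_of_pos a hn
  have hrb := Int.emod_lt_of_pos b hn
  have hsplit : a - b = n * (a / n - b / n) + (a % n - b % n) := by
    rw [mul_sub]
    linarith
  have hr : |a % n - b % n| ≤ n - 1 := by
    rw [abs_le]
    constructor <;> linarith
  calc |a - b| = |n * (a / n - b / n) + (a % n - b % n)| := by rw [hsplit]
    _ ≤ |n * (a / n - b / n)| + |a % n - b % n| := abs_add_le _ _
    _ ≤ n * |a / n - b / n| + (n - 1) := by
        rw [abs_mul, abs_of_pos hn]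
        linarith

/-- labels of window points lie in `[0, L^{m+K−j})`: `0 ≤ ⌊z_μ/L^j⌋ < L^{m+K−j}` for `0 ≤ z_μ < L^{m+K}`. [folklore] -/
private theorem ediv_window {z : ℤ} (hz0 : 0 ≤ z) (hzW : z < ((L ^ (i.m + i.K) : ℕ) : ℤ)) :
    0 ≤ z / ((L ^ i.j : ℕ) : ℤ) ∧ z / ((L ^ i.j : ℕ) : ℤ) < ((L ^ (i.m + i.K - i.j) : ℕ) : ℤ) := by
  have hL0 : 0 < L := by have := hL.2; omega
  have hn : (0 : ℤ) < ((L ^ i.j : ℕ) : ℤ) := by positivity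
  refine ⟨Int.ediv_nonneg hz0 hn.le, Int.ediv_lt_of_lt_mul hn ?_⟩
  have hpow : ((L ^ (i.m + i.K) : ℕ) : ℤ) = ((L ^ (i.m + i.K - i.j) : ℕ) : ℤ) * ((L ^ i.j : ℕ) : ℤ) := by
    rw [← Nat.cast_mul, ← pow_add, Nat.sub_add_cancel (Nat.le_of_succ_le i.hjP)]
  rw [← hpow]
  exact hzW

/-- the window of side `≤ L^{m+K}` lies in the fundamental domain of the fine torus (`2L^{m+K}` sites per direction). [folklore] -/
private theorem lt_sitesPerDir_of_window {w : ℤ} (hw : w < ((L ^ (i.m + i.K) : ℕ) : ℤ)) : w < (i.P.sitesPerDir 0 : ℕ) := by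
  rw [sitesPerDir_zero]
  have h0 : (0 : ℤ) ≤ ((L ^ (i.m + i.K) : ℕ) : ℤ) := by positivity
  push_cast at hw h0 ⊢
  linarith

end LocalTorus

/-! ## §4  The bridge: (2.133) on `T_□` (torus distance of the `j`-blocks) ⟹ the `h2133`-shaped local majorant on ANY global block
geometry whose distance is controlled by the sup-distance of coordinates inside the window -/

section Bridge

open B5Eq118OneStroke (iterBlockOf)
open B4ContourShift (supNorm supNorm_nonneg)
open B6Prop25TwoScaleCensus (TSIdx)
open B6Ineq2133TwoScaleV1 (tsGeo onFun ineq2133_G ineq2133_DG)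

variable {d L : ℕ} {hd : 1 ≤ d + 1} {hL : Odd L ∧ 1 < L} {a₀ a₁ : ℝ} (i : TSIdx d L hd hL a₀ a₁)

end Bridge

/-! ## §5  The bridge FIRED on the genuine nested box family of `B6Geom246MultiLevelBox` (p21): the two geometric inputs — the
distance comparison (`dist_blkOf_le_box`, `κ = c = d + 1`) and the fibre count (`≤ L^{d+1}` charted `j`-blocks over a block of level
`j` or `j + 1`) — DISCHARGED for a window of levels `j, j + 1` with corner in `L^jℤ^{d+1}` -/

section BoxFamily

open B4Reflection242 (boxDom mem_boxDom)
open B4ContourShift (supNorm supNorm_nonneg)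
open B5Eq118OneStroke (iterBlockOf)
open B6LowerBound2153Torus (rep)
open B5Eq117TorusCarriers (Mk)
open B6MultiLevelBoxOperator (N0)
open B6MultiLevelBoxOperatorL0 (Domains)
open B6Geom246MultiLevelBoxL0 (bset blkOf geom bond dist_blkOf_le_box coord_bounds lev_eq_of_blkOf_eq)
open B6Prop25TwoScaleCensus (TSIdx)
open B6Ineq2133TwoScaleV1 (tsGeo onFun ineq2133_G ineq2133_DG)

variable {d ℓ : ℕ} {hd : 1 ≤ d + 1} {hL : Odd (ℓ + 1) ∧ 1 < ℓ + 1} {a₀ a₁ : ℝ} (i : TSIdx d (ℓ + 1) hd hL a₀ a₁)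
variable {Mh k R : ℕ} {P : Fin (d + 1) → ℕ} (D : Domains d ℓ Mh k P R)

/-- the block map of the bonds: `b ↦ y(b₋)` (the block of the initial point, as p38's `fun b => iterBlockOf j b.src` on `T_□`).
[cite: Balaban1984PropagatorsII, (2.133) p.247 («x ∈ Δ(y)»), p.231 («d(x, x′) = d(y, y′) if x ∈ B^j(y)»), dictionary] -/
def blkBond (b : BoxBond ℓ Mh k P) : ↥(bset D) := blkOf D b.1

/-- `(pos, dir)` is injective on bonds (a bond IS its initial point and direction). [folklore] -/
private theorem injOn_pos_dir (W : Finset (BoxBond ℓ Mh k P)) :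
    Set.InjOn (fun b : BoxBond ℓ Mh k P => ((b.1 : Fin (d + 1) → ℤ), b.2)) ↑W := by
  intro b _ b' _ h
  simp only [Prod.mk.injEq] at h
  exact Prod.ext (Subtype.ext h.1) h.2

/-- `rep` is injective: a site of `T^{(j)}` is determined by its labels. [folklore] -/
private theorem rep_injective : Function.Injective (rep (Mk i.P i.j) : Site i.P i.j → Fin (d + 1) → ℤ) := by
  intro y y' h
  funext μ
  have hμ := congrFun h μ
  simp only [rep, Nat.cast_inj] at hμ
  exact ZMod.val_injective _ hμ

/-- **THE DISTANCE INPUT ON THE BOX FAMILY**: for bonds of a window all of whose sites have level `≥ j`, `d(y(b₋), y(b′₋)) ≤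
(d+1)·|b₋ − b′₋|_∞/L^j + (d+1)` — p21's `B6Geom246MultiLevelBoxL0.dist_blkOf_le_box` (the comparison used on p. 232 to read cube estimates in
the form (2.53)), the window being coordinatewise convex. [cite: Balaban1984PropagatorsII, p.232 (before (2.53)), (2.46) p.231] -/
theorem hglob_box (hMh : 1 ≤ Mh) (hP : ∀ μ, 1 ≤ P μ) (x₀ : Fin (d + 1) → ℤ) (Wd : ℕ)
    (hlev : ∀ z ∈ boxDom (N0 ℓ Mh k P), (∀ μ, x₀ μ ≤ z μ ∧ z μ < x₀ μ + Wd) → i.j ≤ D.lev z)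
    (W : Finset (BoxBond ℓ Mh k P)) (hW : ∀ b ∈ W, InWindow (fun b : BoxBond ℓ Mh k P => (b.1 : Fin (d + 1) → ℤ)) x₀ Wd b)
    (S : Set (geom D).Site) :
    ∀ b ∈ W, ∀ b₁ ∈ W, blkBond D b ∈ S → blkBond D b₁ ∈ S →
      (geom D).dist (blkBond D b) (blkBond D b₁) ≤
        (d + 1 : ℝ) * (supNorm ((b.1 : Fin (d + 1) → ℤ) - (b₁.1 : Fin (d + 1) → ℤ)) / (((ℓ + 1) ^ i.j : ℕ) : ℝ)) + (d + 1 : ℝ) := by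
  intro b hb b₁ hb₁ _ _
  have h := dist_blkOf_le_box (D := D) hMh hP b.1 b₁.1 (i := i.j) fun z hz hbox => hlev z hz fun μ => by
    obtain ⟨hlo, hhi⟩ := hbox μ
    have h1 := hW b hb μ
    have h2 := hW b₁ hb₁ μ
    constructor
    · exact le_trans (le_min h1.1 h2.1) hlo
    · exact lt_of_le_of_lt hhi (max_lt h1.2 h2.2)
  show (((bond D).dist (blkOf D b.1) (blkOf D b₁.1) : ℕ) : ℝ) ≤ _
  linarith

/-- **THE FIBRE INPUT ON THE BOX FAMILY**: over a global block of level `j` or `j + 1` meeting the window (corner `x₀ ∈ L^jℤ^{d+1}`)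
there are at most `L^{d+1}` charted `j`-blocks of `T_□` (a block of level `j + 1` IS a cube of `L^{d+1}` blocks of level `j`; one of
level `j` is charted onto one block). [cite: Balaban1984PropagatorsII, (2.1) p.224 («B^j(Ω_j^{(j)})»), (2.89) p.239; Balaban1984PropagatorsI, (1.16)–(1.18) p.20] -/
theorem hfib_box (x₀ : Fin (d + 1) → ℤ) (hx₀ : ∀ μ, (((ℓ + 1) ^ i.j : ℕ) : ℤ) ∣ x₀ μ) (Wd : ℕ) (hWd : Wd ≤ (ℓ + 1) ^ (i.m + i.K))
    (hlev : ∀ z ∈ boxDom (N0 ℓ Mh k P), (∀ μ, x₀ μ ≤ z μ ∧ z μ < x₀ μ + Wd) → i.j ≤ D.lev z ∧ D.lev z ≤ i.j + 1)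
    (W : Finset (BoxBond ℓ Mh k P)) (hW : ∀ b ∈ W, InWindow (fun b : BoxBond ℓ Mh k P => (b.1 : Fin (d + 1) → ℤ)) x₀ Wd b)
    (y : (geom D).Site) :
    ∃ T : Finset (Site i.P i.j), T.card ≤ (ℓ + 1) ^ (d + 1) ∧ ∀ b ∈ W, blkBond D b = y → iterBlockOf i.j
      (chartBond i (fun b : BoxBond ℓ Mh k P => (b.1 : Fin (d + 1) → ℤ)) (fun b => b.2) x₀ b).src ∈ T := by
  classical
  set F := (W.filter (fun b => blkBond D b = y)).image (fun b => iterBlockOf i.j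
      (chartBond i (fun b : BoxBond ℓ Mh k P => (b.1 : Fin (d + 1) → ℤ)) (fun b => b.2) x₀ b).src) with hF
  have hmemF : ∀ b ∈ W, blkBond D b = y → iterBlockOf i.j
      (chartBond i (fun b : BoxBond ℓ Mh k P => (b.1 : Fin (d + 1) → ℤ)) (fun b => b.2) x₀ b).src ∈ F := fun b hb hby =>
    Finset.mem_image.mpr ⟨b, Finset.mem_filter.mpr ⟨hb, hby⟩, rfl⟩
  refine ⟨F, ?_, hmemF⟩
  by_cases hne : (W.filter (fun b => blkBond D b = y)) = ∅
  · rw [hF, hne, Finset.image_empty, Finset.card_empty]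
    exact Nat.zero_le _
  obtain ⟨b₀, hb₀⟩ := Finset.nonempty_iff_ne_empty.mpr hne
  obtain ⟨hb₀W, hb₀y⟩ := Finset.mem_filter.mp hb₀
  -- the level `t` of the block `y` and its range
  set t := y.1.1 with ht
  have hwin₀ := hW b₀ hb₀W
  have htlev : D.lev (b₀.1 : Fin (d + 1) → ℤ) = t := lev_eq_of_blkOf_eq D hb₀y
  have ht_range : i.j ≤ t ∧ t ≤ i.j + 1 := by
    rw [← htlev]
    exact hlev _ b₀.1.2 hwin₀
  have hL1 : 1 ≤ ℓ + 1 := by omega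
  have hLpos : (0 : ℤ) < (((ℓ + 1) ^ i.j : ℕ) : ℤ) := by positivity
  -- the divisibility `L^j ∣ L^t·y_μ − x₀_μ`
  have hdvd : ∀ μ, (((ℓ + 1) ^ i.j : ℕ) : ℤ) ∣ (((ℓ + 1) ^ t : ℕ) : ℤ) * y.1.2 μ - x₀ μ := fun μ =>
    dvd_sub (dvd_mul_of_dvd_left (by exact_mod_cast pow_dvd_pow (ℓ + 1) ht_range.1) _) (hx₀ μ)
  -- the label box
  set a : Fin (d + 1) → ℤ := fun μ => ((((ℓ + 1) ^ t : ℕ) : ℤ) * y.1.2 μ - x₀ μ) / (((ℓ + 1) ^ i.j : ℕ) : ℤ) with ha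
  set B : Finset (Fin (d + 1) → ℤ) := Fintype.piFinset fun μ => Finset.Ico (a μ) (a μ + (ℓ + 1 : ℕ)) with hB
  have hBcard : B.card = (ℓ + 1) ^ (d + 1) := by
    rw [hB, Fintype.card_piFinset]
    simp only [Int.card_Ico, add_sub_cancel_left, Int.toNat_natCast, Finset.prod_const, Finset.card_univ,
      Fintype.card_fin]
  -- every charted block of the fibre has its labels in the box
  have hinto : ∀ s ∈ F, rep (Mk i.P i.j) s ∈ B := by
    intro s hs
    obtain ⟨b, hb, rfl⟩ := Finset.mem_image.mp hs
    obtain ⟨hbW, hby⟩ := Finset.mem_filter.mp hb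
    have hwin := hW b hbW
    have hz0 : ∀ μ, 0 ≤ (b.1 : Fin (d + 1) → ℤ) μ - x₀ μ := fun μ => by have := (hwin μ).1; linarith
    have hzN : ∀ μ, (b.1 : Fin (d + 1) → ℤ) μ - x₀ μ < (i.P.sitesPerDir 0 : ℕ) := fun μ => by
      refine lt_sitesPerDir_of_window i ?_
      have := (hwin μ).2
      have hc : ((Wd : ℕ) : ℤ) ≤ (((ℓ + 1) ^ (i.m + i.K) : ℕ) : ℤ) := by exact_mod_cast hWd
      linarith
    rw [hB, Fintype.mem_piFinset]
    intro μ
    rw [Finset.mem_Ico, chartBond_src, rep_iterBlockOf_siteOfInt i hz0 hzN μ]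
    obtain ⟨hlo, hhi⟩ := coord_bounds D hby μ
    have hlo' : (((ℓ + 1) ^ t : ℕ) : ℤ) * y.1.2 μ - x₀ μ ≤ (b.1 : Fin (d + 1) → ℤ) μ - x₀ μ := by
      have : (((ℓ + 1) ^ y.1.1 : ℕ) : ℤ) = (((ℓ + 1) ^ t : ℕ) : ℤ) := by rw [ht]
      linarith
    constructor
    · exact Int.ediv_le_ediv hLpos hlo'
    · -- `(b_μ − x₀_μ) < (a_μ + L)·L^j`
      refine Int.ediv_lt_of_lt_mul hLpos ?_
      have hmul : a μ * (((ℓ + 1) ^ i.j : ℕ) : ℤ) = (((ℓ + 1) ^ t : ℕ) : ℤ) * y.1.2 μ - x₀ μ :=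
        Int.ediv_mul_cancel (hdvd μ)
      have hpow : (((ℓ + 1) ^ t : ℕ) : ℤ) ≤ ((ℓ + 1 : ℕ) : ℤ) * (((ℓ + 1) ^ i.j : ℕ) : ℤ) := by
        rw [← Nat.cast_mul, ← pow_succ']
        exact_mod_cast Nat.pow_le_pow_right hL1 ht_range.2
      have hhi' : (b.1 : Fin (d + 1) → ℤ) μ < (((ℓ + 1) ^ t : ℕ) : ℤ) * y.1.2 μ + (((ℓ + 1) ^ t : ℕ) : ℤ) := by
        have : (((ℓ + 1) ^ y.1.1 : ℕ) : ℤ) = (((ℓ + 1) ^ t : ℕ) : ℤ) := by rw [ht]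
        linarith
      nlinarith
  calc F.card ≤ B.card := Finset.card_le_card_of_injOn (rep (Mk i.P i.j)) hinto ((rep_injective i).injOn)
    _ = (ℓ + 1) ^ (d + 1) := hBcard

/-- **(2.133) ⟹ `h2133` ON THE GENUINE NESTED BOX FAMILY** (B6-CLOSURE §5 item 6 (c), the geometry bridge, FIRED): ONE `δ₂ > 0`, ONE
`A ≥ 0` (on `d, L, a₀, a₁`) such that for every member `G_□` of the two-scale family (census index `TSIdx`), every nested box family `D`
(`B6MultiLevelBoxOperatorL0.Domains`, `M_h ≥ 1`, `P_μ ≥ 1`), every window (corner `x₀ ∈ L^jℤ^{d+1}`, side `W ≤ L^{m+K}`, all of whose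
box sites have level `j` or `j + 1` — the two-level window of a cube «connected with the L^jη-scale», p. 238), every finite set `W`
of bonds of the window and every reach `S ⊂ 𝔅`: the transplanted `G_□` has the LOCAL MAJORANT
`L^{d+1}·A·e^{2δ₂}·e^{−(δ₂/(d+1))·d(y,y′)}` on `S` for the geometry `geom D` (distance (2.46), reading R2) and the block map
`b ↦ y(b₋)` — literally the hypothesis `h2133` of `B6Prop26Gluing.prop26_2136_of_2133_2134_lemma21` (with `P ≡ 1`, rate `δ₂/(d+1)`
in place of print's `½δ₂`).  HONEST SCOPE in the module docstring. [cite: Balaban1984PropagatorsII, (2.133) p.247, (2.90)–(2.91) p.239, Prop. 2.5 p.246, Prop. 2.6 p.247] -/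
theorem reach2133_G_box (d ℓ : ℕ) (hd : 1 ≤ d + 1) (hL : Odd (ℓ + 1) ∧ 1 < ℓ + 1) {a₀ a₁ : ℝ} (ha₀ : 0 < a₀) (ha₁ : a₀ ≤ a₁) :
    ∃ δ : ℝ, 0 < δ ∧ ∃ A : ℝ, 0 ≤ A ∧ ∀ (i : TSIdx d (ℓ + 1) hd hL a₀ a₁) {Mh k R : ℕ} {P : Fin (d + 1) → ℕ}
      (D : B6MultiLevelBoxOperatorL0.Domains d ℓ Mh k P R) (_ : 1 ≤ Mh) (_ : ∀ μ, 1 ≤ P μ) (x₀ : Fin (d + 1) → ℤ)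
      (_ : ∀ μ, (((ℓ + 1) ^ i.j : ℕ) : ℤ) ∣ x₀ μ) (Wd : ℕ) (_ : Wd ≤ (ℓ + 1) ^ (i.m + i.K))
      (_ : ∀ z ∈ boxDom (N0 ℓ Mh k P), (∀ μ, x₀ μ ≤ z μ ∧ z μ < x₀ μ + Wd) → i.j ≤ D.lev z ∧ D.lev z ≤ i.j + 1)
      (W : Finset (BoxBond ℓ Mh k P)) (_ : ∀ b ∈ W, InWindow (fun b : BoxBond ℓ Mh k P => (b.1 : Fin (d + 1) → ℤ)) x₀ Wd b)
      (S : Set (geom D).Site),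
      LocalMajorant (g := geom D) (blkBond D)
        (transplant W (chartBond i (fun b : BoxBond ℓ Mh k P => (b.1 : Fin (d + 1) → ℤ)) (fun b => b.2) x₀) (onFun i.D.G)) S
        (fun a b => ((ℓ + 1) ^ (d + 1) : ℕ) * ((A * Real.exp (δ * ((d + 1 : ℝ) + (d + 1)) / (d + 1))) *
          Real.exp (-(δ / (d + 1) * (geom D).dist a b)))) := by
  obtain ⟨δ, hδ, A, hA, h⟩ := reach2133_G d (ℓ + 1) hd hL ha₀ ha₁
  refine ⟨δ, hδ, A, hA, fun i Mh k R P D hMh hP x₀ hx₀ Wd hWd hlev W hW S => ?_⟩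
  classical
  exact h i (blkBond D) S (fun b : BoxBond ℓ Mh k P => (b.1 : Fin (d + 1) → ℤ)) (fun b => b.2) x₀ hWd W hW (injOn_pos_dir W)
    (d + 1) (d + 1) (by positivity) (hglob_box i D hMh hP x₀ Wd (fun z hz hw => (hlev z hz hw).1) W hW S) ((ℓ + 1) ^ (d + 1))
    (fun y _ => hfib_box i D x₀ hx₀ Wd hWd hlev W hW y)

/-- the `∇_λG_□` twin of `reach2133_G_box` (second entry of (2.133)), every direction `λ`. [cite: Balaban1984PropagatorsII, (2.133) p.247, Prop. 2.5 p.246] -/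
theorem reach2133_DG_box (d ℓ : ℕ) (hd : 1 ≤ d + 1) (hL : Odd (ℓ + 1) ∧ 1 < ℓ + 1) {a₀ a₁ : ℝ} (ha₀ : 0 < a₀) (ha₁ : a₀ ≤ a₁) :
    ∃ δ : ℝ, 0 < δ ∧ ∃ A : ℝ, 0 ≤ A ∧ ∀ (i : TSIdx d (ℓ + 1) hd hL a₀ a₁) (lam : Fin i.P.d) {Mh k R : ℕ} {P : Fin (d + 1) → ℕ}
      (D : B6MultiLevelBoxOperatorL0.Domains d ℓ Mh k P R) (_ : 1 ≤ Mh) (_ : ∀ μ, 1 ≤ P μ) (x₀ : Fin (d + 1) → ℤ)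
      (_ : ∀ μ, (((ℓ + 1) ^ i.j : ℕ) : ℤ) ∣ x₀ μ) (Wd : ℕ) (_ : Wd ≤ (ℓ + 1) ^ (i.m + i.K))
      (_ : ∀ z ∈ boxDom (N0 ℓ Mh k P), (∀ μ, x₀ μ ≤ z μ ∧ z μ < x₀ μ + Wd) → i.j ≤ D.lev z ∧ D.lev z ≤ i.j + 1)
      (W : Finset (BoxBond ℓ Mh k P)) (_ : ∀ b ∈ W, InWindow (fun b : BoxBond ℓ Mh k P => (b.1 : Fin (d + 1) → ℤ)) x₀ Wd b)
      (S : Set (geom D).Site),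
      LocalMajorant (g := geom D) (blkBond D)
        (transplant W (chartBond i (fun b : BoxBond ℓ Mh k P => (b.1 : Fin (d + 1) → ℤ)) (fun b => b.2) x₀)
          (onFun (i.Dl lam ∘ₗ i.D.G))) S
        (fun a b => ((ℓ + 1) ^ (d + 1) : ℕ) * ((A * Real.exp (δ * ((d + 1 : ℝ) + (d + 1)) / (d + 1))) *
          Real.exp (-(δ / (d + 1) * (geom D).dist a b)))) := by
  obtain ⟨δ, hδ, A, hA, h⟩ := reach2133_DG d (ℓ + 1) hd hL ha₀ ha₁
  refine ⟨δ, hδ, A, hA, fun i lam Mh k R P D hMh hP x₀ hx₀ Wd hWd hlev W hW S => ?_⟩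
  classical
  exact h i lam (blkBond D) S (fun b : BoxBond ℓ Mh k P => (b.1 : Fin (d + 1) → ℤ)) (fun b => b.2) x₀ hWd W hW (injOn_pos_dir W)
    (d + 1) (d + 1) (by positivity) (hglob_box i D hMh hP x₀ Wd (fun z hz hw => (hlev z hz hw).1) W hW S) ((ℓ + 1) ^ (d + 1))
    (fun y _ => hfib_box i D x₀ hx₀ Wd hWd hlev W hW y)

end BoxFamily

/-! ## §6  The same on print's own carrier `T_η` (p21's torus family `TDomains`, geometry `geomT`): a window of the fundamental box
(not wrapping around `T_η`; wrapping windows go through the translation charts of `B6Geom246MultiLevelTorusL0.distT_le_dist_chart`) -/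

section TorusFamily

open B4Reflection242 (boxDom)
open B4ContourShift (supNorm)
open B5Eq118OneStroke (iterBlockOf)
open B6MultiLevelBoxOperator (N0)
open B6MultiLevelBoxOperatorL0 (Domains)
open B6MultiLevelTorusOperatorL0 (TDomains)
open B6Geom246MultiLevelBoxL0 (bset blkOf geom bond)
open B6Geom246MultiLevelTorusL0 (geomT bondT distT_le_dist_box)
open B6Prop25TwoScaleCensus (TSIdx)
open B6Ineq2133TwoScaleV1 (onFun)

variable {d ℓ : ℕ} {hd : 1 ≤ d + 1} {hL : Odd (ℓ + 1) ∧ 1 < ℓ + 1} {a₀ a₁ : ℝ} (i : TSIdx d (ℓ + 1) hd hL a₀ a₁)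
variable {Mh k R : ℕ} {P : Fin (d + 1) → ℕ} (D : TDomains d ℓ Mh k P R)

/-- **THE DISTANCE INPUT ON THE TORUS FAMILY**: `d_T ≤ d_box` on the same blocks (`distT_le_dist_box`: every bond of the fundamental box
is a bond of the torus), so the box comparison `hglob_box` for `D.toDomains` is a comparison for `geomT D`.
[cite: Balaban1984PropagatorsII, (2.46) p.231, p.224 («Ω_j ⊂ T_η»)] -/
theorem hglob_torus (hMh : 1 ≤ Mh) (hP : ∀ μ, 1 ≤ P μ) (x₀ : Fin (d + 1) → ℤ) (Wd : ℕ)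
    (hlev : ∀ z ∈ boxDom (N0 ℓ Mh k P), (∀ μ, x₀ μ ≤ z μ ∧ z μ < x₀ μ + Wd) → i.j ≤ D.lev z)
    (W : Finset (BoxBond ℓ Mh k P)) (hW : ∀ b ∈ W, InWindow (fun b : BoxBond ℓ Mh k P => (b.1 : Fin (d + 1) → ℤ)) x₀ Wd b)
    (S : Set (geomT D).Site) :
    ∀ b ∈ W, ∀ b₁ ∈ W, blkBond D.toDomains b ∈ S → blkBond D.toDomains b₁ ∈ S →
      (geomT D).dist (blkBond D.toDomains b) (blkBond D.toDomains b₁) ≤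
        (d + 1 : ℝ) * (supNorm ((b.1 : Fin (d + 1) → ℤ) - (b₁.1 : Fin (d + 1) → ℤ)) / (((ℓ + 1) ^ i.j : ℕ) : ℝ)) + (d + 1 : ℝ) := by
  intro b hb b₁ hb₁ _ _
  have hbox := hglob_box i D.toDomains hMh hP x₀ Wd hlev W hW Set.univ b hb b₁ hb₁ (Set.mem_univ _) (Set.mem_univ _)
  have hT : (((bondT D).dist (blkBond D.toDomains b) (blkBond D.toDomains b₁) : ℕ) : ℝ)
      ≤ (((bond D.toDomains).dist (blkBond D.toDomains b) (blkBond D.toDomains b₁) : ℕ) : ℝ) := by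
    exact_mod_cast distT_le_dist_box (D := D) hMh hP _ _
  exact hT.trans hbox

/-- **(2.133) ⟹ `h2133` ON THE GENUINE NESTED TORUS FAMILY `T_η`** (print's carrier, p21's `TDomains`/`geomT`, distance (2.46) with bonds
across the torus): as `reach2133_G_box`, for windows of the fundamental box, with the majorant in `d_T`.
[cite: Balaban1984PropagatorsII, (2.133) p.247, (2.90)–(2.91) p.239, Prop. 2.6 p.247, p.224 («Ω_j ⊂ T_η»)] -/
theorem reach2133_G_torus (d ℓ : ℕ) (hd : 1 ≤ d + 1) (hL : Odd (ℓ + 1) ∧ 1 < ℓ + 1) {a₀ a₁ : ℝ} (ha₀ : 0 < a₀) (ha₁ : a₀ ≤ a₁) :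
    ∃ δ : ℝ, 0 < δ ∧ ∃ A : ℝ, 0 ≤ A ∧ ∀ (i : TSIdx d (ℓ + 1) hd hL a₀ a₁) {Mh k R : ℕ} {P : Fin (d + 1) → ℕ}
      (D : B6MultiLevelTorusOperatorL0.TDomains d ℓ Mh k P R) (_ : 1 ≤ Mh) (_ : ∀ μ, 1 ≤ P μ) (x₀ : Fin (d + 1) → ℤ)
      (_ : ∀ μ, (((ℓ + 1) ^ i.j : ℕ) : ℤ) ∣ x₀ μ) (Wd : ℕ) (_ : Wd ≤ (ℓ + 1) ^ (i.m + i.K))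
      (_ : ∀ z ∈ boxDom (N0 ℓ Mh k P), (∀ μ, x₀ μ ≤ z μ ∧ z μ < x₀ μ + Wd) → i.j ≤ D.lev z ∧ D.lev z ≤ i.j + 1)
      (W : Finset (BoxBond ℓ Mh k P)) (_ : ∀ b ∈ W, InWindow (fun b : BoxBond ℓ Mh k P => (b.1 : Fin (d + 1) → ℤ)) x₀ Wd b)
      (S : Set (geomT D).Site),
      LocalMajorant (g := geomT D) (blkBond D.toDomains)
        (transplant W (chartBond i (fun b : BoxBond ℓ Mh k P => (b.1 : Fin (d + 1) → ℤ)) (fun b => b.2) x₀) (onFun i.D.G)) S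
        (fun a b => ((ℓ + 1) ^ (d + 1) : ℕ) * ((A * Real.exp (δ * ((d + 1 : ℝ) + (d + 1)) / (d + 1))) *
          Real.exp (-(δ / (d + 1) * (geomT D).dist a b)))) := by
  obtain ⟨δ, hδ, A, hA, h⟩ := reach2133_G d (ℓ + 1) hd hL ha₀ ha₁
  refine ⟨δ, hδ, A, hA, fun i Mh k R P D hMh hP x₀ hx₀ Wd hWd hlev W hW S => ?_⟩
  classical
  exact h i (blkBond D.toDomains) S (fun b : BoxBond ℓ Mh k P => (b.1 : Fin (d + 1) → ℤ)) (fun b => b.2) x₀ hWd W hW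
    (injOn_pos_dir W) (d + 1) (d + 1) (by positivity)
    (hglob_torus i D hMh hP x₀ Wd (fun z hz hw => (hlev z hz hw).1) W hW S) ((ℓ + 1) ^ (d + 1))
    (fun y _ => hfib_box i D.toDomains x₀ hx₀ Wd hWd hlev W hW y)

end TorusFamily

/-! ## §7  (v1.1) The same ON THE CARRIERS OF THE (2.134) FILES (p38's `B6Ineq2134ThetaKLevel`: member `i : KIdx d ℓ`, geometry
`geoB i` in print's units, bonds `XV i = Fin (d+1) × ↥i.XB`, block map `blkV i`), IN PRINT'S `η`-UNITS: `G_□^η = (L^jη)²·G_□^ξ` (2.94), so the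
majorant carries the weight `(L^jη)² ≤ len(y″)²` — EXACTLY the hypothesis `hG` of `B6Ineq2134ThetaKLevelL0.ineq2134_kOff_kLevel` -/

section GeoB

open B4Reflection242 (boxDom mem_boxDom)
open B4ContourShift (supNorm supNorm_nonneg)
open B5Eq118OneStroke (iterBlockOf)
open B6LowerBound2153Torus (rep)
open B5Eq117TorusCarriers (Mk)
open B6MultiLevelBoxOperator (N0)
open B6MultiLevelBoxOperatorL0 (Domains)
open B6Geom246MultiLevelBoxL0 (bset blkOf geom bond dist_blkOf_le_box coord_bounds lev_eq_of_blkOf_eq)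
open B6Prop25TwoScaleCensus (TSIdx)
open B6Ineq2133TwoScaleV1 (tsGeo onFun ineq2133_G ineq2133_DG)
open B6Prop22KLevelCensusL0 (KIdx)
open B6Prop22KLevelCensusEtaL0 (nK)
open B6Ineq288MultiLevelBoxL0 (geoB geoB_dist geoB_len)
open B6Ineq2134ThetaKLevelL0 (XV blkV)

variable {d ℓ : ℕ} {hd : 1 ≤ d + 1} {hL : Odd (ℓ + 1) ∧ 1 < ℓ + 1} {a₀ a₁ : ℝ} (t : TSIdx d (ℓ + 1) hd hL a₀ a₁)

variable {Mh k R : ℕ} {P : Fin (d + 1) → ℕ} (D : Domains d ℓ Mh k P R)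

/-- **THE DISTANCE INPUT for any global lattice over the box sites** (`site : X → X_box`; e.g. p38's `XV i`, `site = Prod.snd`): p21's
`dist_blkOf_le_box` on a coordinatewise convex window of levels `≥ j`. [cite: Balaban1984PropagatorsII, p.232 (before (2.53)), (2.46) p.231] -/
theorem hglob_sites (hMh : 1 ≤ Mh) (hP : ∀ μ, 1 ≤ P μ) {X : Type} (site : X → ↥(boxDom (N0 ℓ Mh k P))) (x₀ : Fin (d + 1) → ℤ)
    (Wd : ℕ) (hlev : ∀ z ∈ boxDom (N0 ℓ Mh k P), (∀ μ, x₀ μ ≤ z μ ∧ z μ < x₀ μ + Wd) → t.j ≤ D.lev z)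
    (W : Finset X) (hW : ∀ x ∈ W, InWindow (fun x => (site x : Fin (d + 1) → ℤ)) x₀ Wd x) (S : Set ↥(B6Geom246MultiLevelBoxL0.bset D)) :
    ∀ x ∈ W, ∀ x₁ ∈ W, blkOf D (site x) ∈ S → blkOf D (site x₁) ∈ S →
      (geom D).dist (blkOf D (site x)) (blkOf D (site x₁)) ≤
        (d + 1 : ℝ) * (supNorm ((site x : Fin (d + 1) → ℤ) - (site x₁ : Fin (d + 1) → ℤ)) / (((ℓ + 1) ^ t.j : ℕ) : ℝ)) + (d + 1 : ℝ) := by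
  intro x hx x₁ hx₁ _ _
  have h := dist_blkOf_le_box (D := D) hMh hP (site x) (site x₁) (i := t.j) fun z hz hbox => hlev z hz fun μ => by
    obtain ⟨hlo, hhi⟩ := hbox μ
    have h1 := hW x hx μ
    have h2 := hW x₁ hx₁ μ
    constructor
    · exact le_trans (le_min h1.1 h2.1) hlo
    · exact lt_of_le_of_lt hhi (max_lt h1.2 h2.2)
  show (((bond D).dist (blkOf D (site x)) (blkOf D (site x₁)) : ℕ) : ℝ) ≤ _
  linarith

/-- **THE FIBRE INPUT for any global lattice over the box sites**: `≤ L^{d+1}` charted `j`-blocks over a global block of level `j` or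
`j + 1` meeting the window (corner in `L^jℤ^{d+1}`). [cite: Balaban1984PropagatorsII, (2.1) p.224, (2.89) p.239; Balaban1984PropagatorsI, (1.16)–(1.18) p.20] -/
theorem hfib_sites {X : Type} (site : X → ↥(boxDom (N0 ℓ Mh k P))) (dir : X → Fin (d + 1)) (x₀ : Fin (d + 1) → ℤ)
    (hx₀ : ∀ μ, (((ℓ + 1) ^ t.j : ℕ) : ℤ) ∣ x₀ μ) (Wd : ℕ) (hWd : Wd ≤ (ℓ + 1) ^ (t.m + t.K))
    (hlev : ∀ z ∈ boxDom (N0 ℓ Mh k P), (∀ μ, x₀ μ ≤ z μ ∧ z μ < x₀ μ + Wd) → t.j ≤ D.lev z ∧ D.lev z ≤ t.j + 1)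
    (W : Finset X) (hW : ∀ x ∈ W, InWindow (fun x => (site x : Fin (d + 1) → ℤ)) x₀ Wd x) (y : ↥(B6Geom246MultiLevelBoxL0.bset D)) :
    ∃ T : Finset (Site t.P t.j), T.card ≤ (ℓ + 1) ^ (d + 1) ∧ ∀ x ∈ W, blkOf D (site x) = y → iterBlockOf t.j
      (chartBond t (fun x => (site x : Fin (d + 1) → ℤ)) dir x₀ x).src ∈ T := by
  classical
  set F := (W.filter (fun x => blkOf D (site x) = y)).image (fun x => iterBlockOf t.j
      (chartBond t (fun x => (site x : Fin (d + 1) → ℤ)) dir x₀ x).src) with hF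
  have hmemF : ∀ x ∈ W, blkOf D (site x) = y → iterBlockOf t.j
      (chartBond t (fun x => (site x : Fin (d + 1) → ℤ)) dir x₀ x).src ∈ F := fun x hx hxy =>
    Finset.mem_image.mpr ⟨x, Finset.mem_filter.mpr ⟨hx, hxy⟩, rfl⟩
  refine ⟨F, ?_, hmemF⟩
  by_cases hne : (W.filter (fun x => blkOf D (site x) = y)) = ∅
  · rw [hF, hne, Finset.image_empty, Finset.card_empty]
    exact Nat.zero_le _
  obtain ⟨b₀, hb₀⟩ := Finset.nonempty_iff_ne_empty.mpr hne
  obtain ⟨hb₀W, hb₀y⟩ := Finset.mem_filter.mp hb₀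
  set tl := y.1.1 with ht
  have hwin₀ := hW b₀ hb₀W
  have htlev : D.lev (site b₀ : Fin (d + 1) → ℤ) = tl := lev_eq_of_blkOf_eq D hb₀y
  have ht_range : t.j ≤ tl ∧ tl ≤ t.j + 1 := by
    rw [← htlev]
    exact hlev _ (site b₀).2 hwin₀
  have hL1 : 1 ≤ ℓ + 1 := by omega
  have hLpos : (0 : ℤ) < (((ℓ + 1) ^ t.j : ℕ) : ℤ) := by positivity
  have hdvd : ∀ μ, (((ℓ + 1) ^ t.j : ℕ) : ℤ) ∣ (((ℓ + 1) ^ tl : ℕ) : ℤ) * y.1.2 μ - x₀ μ := fun μ =>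
    dvd_sub (dvd_mul_of_dvd_left (by exact_mod_cast pow_dvd_pow (ℓ + 1) ht_range.1) _) (hx₀ μ)
  set a : Fin (d + 1) → ℤ := fun μ => ((((ℓ + 1) ^ tl : ℕ) : ℤ) * y.1.2 μ - x₀ μ) / (((ℓ + 1) ^ t.j : ℕ) : ℤ) with ha
  set B : Finset (Fin (d + 1) → ℤ) := Fintype.piFinset fun μ => Finset.Ico (a μ) (a μ + (ℓ + 1 : ℕ)) with hB
  have hBcard : B.card = (ℓ + 1) ^ (d + 1) := by
    rw [hB, Fintype.card_piFinset]
    simp only [Int.card_Ico, add_sub_cancel_left, Int.toNat_natCast, Finset.prod_const, Finset.card_univ,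
      Fintype.card_fin]
  have hinto : ∀ s ∈ F, rep (Mk t.P t.j) s ∈ B := by
    intro s hs
    obtain ⟨b, hb, rfl⟩ := Finset.mem_image.mp hs
    obtain ⟨hbW, hby⟩ := Finset.mem_filter.mp hb
    have hwin := hW b hbW
    have hz0 : ∀ μ, 0 ≤ (site b : Fin (d + 1) → ℤ) μ - x₀ μ := fun μ => by have := (hwin μ).1; linarith
    have hzN : ∀ μ, (site b : Fin (d + 1) → ℤ) μ - x₀ μ < (t.P.sitesPerDir 0 : ℕ) := fun μ => by
      refine lt_sitesPerDir_of_window t ?_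
      have := (hwin μ).2
      have hc : ((Wd : ℕ) : ℤ) ≤ (((ℓ + 1) ^ (t.m + t.K) : ℕ) : ℤ) := by exact_mod_cast hWd
      linarith
    rw [hB, Fintype.mem_piFinset]
    intro μ
    rw [Finset.mem_Ico, chartBond_src, rep_iterBlockOf_siteOfInt t hz0 hzN μ]
    obtain ⟨hlo, hhi⟩ := coord_bounds D hby μ
    have hlo' : (((ℓ + 1) ^ tl : ℕ) : ℤ) * y.1.2 μ - x₀ μ ≤ (site b : Fin (d + 1) → ℤ) μ - x₀ μ := by
      have : (((ℓ + 1) ^ y.1.1 : ℕ) : ℤ) = (((ℓ + 1) ^ tl : ℕ) : ℤ) := by rw [ht]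
      linarith
    constructor
    · exact Int.ediv_le_ediv hLpos hlo'
    · refine Int.ediv_lt_of_lt_mul hLpos ?_
      have hmul : a μ * (((ℓ + 1) ^ t.j : ℕ) : ℤ) = (((ℓ + 1) ^ tl : ℕ) : ℤ) * y.1.2 μ - x₀ μ :=
        Int.ediv_mul_cancel (hdvd μ)
      have hpow : (((ℓ + 1) ^ tl : ℕ) : ℤ) ≤ ((ℓ + 1 : ℕ) : ℤ) * (((ℓ + 1) ^ t.j : ℕ) : ℤ) := by
        rw [← Nat.cast_mul, ← pow_succ']
        exact_mod_cast Nat.pow_le_pow_right hL1 ht_range.2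
      have hhi' : (site b : Fin (d + 1) → ℤ) μ < (((ℓ + 1) ^ tl : ℕ) : ℤ) * y.1.2 μ + (((ℓ + 1) ^ tl : ℕ) : ℤ) := by
        have : (((ℓ + 1) ^ y.1.1 : ℕ) : ℤ) = (((ℓ + 1) ^ tl : ℕ) : ℤ) := by rw [ht]
        linarith
      nlinarith
  calc F.card ≤ B.card := Finset.card_le_card_of_injOn (rep (Mk t.P t.j)) hinto ((rep_injective t).injOn)
    _ = (ℓ + 1) ^ (d + 1) := hBcard

variable {D}

/-- **`G_□` IN PRINT'S UNITS ON THE CARRIERS OF THE (2.134) FILES**: `(L^jη)² • transplant W (chartBond …) (onFun G_□^ξ)` on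
`XV i = Fin (d+1) × ↥i.XB` (direction, initial point), `η = L^{−k}` of the member `i : KIdx d ℓ` — the operator `G_□` of (2.90) read on
`T_η` as in `G₀ = Σ h_□G_□h_□`, rescaled by (2.94) `G^η_□ = (L^jη)²G^ξ_□`. [cite: Balaban1984PropagatorsII, (2.90)–(2.91), (2.94) p.239] -/
def GlEta (i : KIdx d ℓ) (W : Finset (XV i)) (x₀ : Fin (d + 1) → ℤ) : Module.End ℝ (XV i → ℝ) :=
  ((((ℓ : ℝ) + 1) ^ t.j * (((nK i : ℕ) : ℝ))⁻¹) ^ 2) •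
    transplant W (chartBond t (fun q : XV i => ((q.2 : ↥(i.XB)) : Fin (d + 1) → ℤ)) (fun q => q.1) x₀) (onFun t.D.G)

/-- **`∇_λG_□` IN PRINT'S UNITS** on the same carriers: `(L^jη) • transplant … (onFun (∇^ξ_λ ∘ G_□^ξ))` (`∇^η G^η_□ = (L^jη)·∇^ξG^ξ_□`, (2.94) «and
correspondingly for derivatives of G_□»). [cite: Balaban1984PropagatorsII, (2.94) p.239, (2.133) p.247] -/
def DGlEta (i : KIdx d ℓ) (lam : Fin t.P.d) (W : Finset (XV i)) (x₀ : Fin (d + 1) → ℤ) : Module.End ℝ (XV i → ℝ) :=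
  ((((ℓ : ℝ) + 1) ^ t.j * (((nK i : ℕ) : ℝ))⁻¹)) •
    transplant W (chartBond t (fun q : XV i => ((q.2 : ↥(i.XB)) : Fin (d + 1) → ℤ)) (fun q => q.1) x₀) (onFun (t.Dl lam ∘ₗ t.D.G))

/-- on blocks of level `≥ j`, `(L^jη)^p ≤ len(y)^p`. [cite: Balaban1984PropagatorsII, (2.1) p.224 («L^jη»), dictionary] -/
private theorem scale_pow_le_len_pow (i : KIdx d ℓ) (p : ℕ) {a : ↥(bset i.D)} (ha : t.j ≤ a.1.1) :
    ((((ℓ : ℝ) + 1) ^ t.j * (((nK i : ℕ) : ℝ))⁻¹)) ^ p ≤ (geoB i).len a ^ p := by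
  rw [geoB_len]
  have hL : (1 : ℝ) ≤ (ℓ : ℝ) + 1 := by
    have : (0 : ℝ) ≤ (ℓ : ℝ) := Nat.cast_nonneg _
    linarith
  have hη : (0 : ℝ) ≤ (((nK i : ℕ) : ℝ))⁻¹ := by positivity
  exact pow_le_pow_left₀ (by positivity) (mul_le_mul_of_nonneg_right (pow_le_pow_right₀ hL ha) hη) p

/-- **(2.133) ⟹ THE `hG` OF `B6Ineq2134ThetaKLevelL0.ineq2134_kOff_kLevel`** (B6-CLOSURE §5 item 6 (c) delivered in the shape item 6 (b) consumes):
ONE `δ_G > 0`, ONE `C_G ≥ 0` (on `d, L, a₀, a₁`) such that for every two-scale member `t` (scales `j, j+1`), every `i : KIdx d ℓ`, every window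
(corner `x₀ ∈ L^jℤ^{d+1}`, side `≤ L^{m+K}` of the member, all box sites of level `j` or `j+1`), every finite set `W ⊂ XV i` of window bonds and
every reach `S` of blocks of level `≥ j`:
`LocalMajorant (g := geoB i) (blkV i) (GlEta t i W x₀) S (fun y″ y′ => C_G * (geoB i).len y″ ^ 2 * e^{−δ_G·d(y″,y′)})` — with
`C_G = L^{d+1}·A·e^{2δ₂}`, `δ_G = δ₂/(d+1)` from p38's `ineq2133_G` (`δ₂`, `A`). [cite: Balaban1984PropagatorsII, (2.133)–(2.134) p.247, (2.94) p.239, Prop. 2.5 p.246] -/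
theorem reach2133_G_geoB (d ℓ : ℕ) (hd : 1 ≤ d + 1) (hL : Odd (ℓ + 1) ∧ 1 < ℓ + 1) {a₀ a₁ : ℝ} (ha₀ : 0 < a₀) (ha₁ : a₀ ≤ a₁) :
    ∃ δG : ℝ, 0 < δG ∧ ∃ CG : ℝ, 0 ≤ CG ∧ ∀ (t : TSIdx d (ℓ + 1) hd hL a₀ a₁) (i : B6Prop22KLevelCensusL0.KIdx d ℓ) (x₀ : Fin (d + 1) → ℤ)
      (_ : ∀ μ, (((ℓ + 1) ^ t.j : ℕ) : ℤ) ∣ x₀ μ) (Wd : ℕ) (_ : Wd ≤ (ℓ + 1) ^ (t.m + t.K))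
      (_ : ∀ z ∈ boxDom (N0 ℓ i.Mh i.k i.P), (∀ μ, x₀ μ ≤ z μ ∧ z μ < x₀ μ + Wd) → t.j ≤ i.D.lev z ∧ i.D.lev z ≤ t.j + 1)
      (W : Finset (XV i)) (_ : ∀ q ∈ W, InWindow (fun q : XV i => ((q.2 : ↥(i.XB)) : Fin (d + 1) → ℤ)) x₀ Wd q)
      (S : Set (geoB i).Site) (_ : ∀ a ∈ S, t.j ≤ a.1.1),
      LocalMajorant (g := geoB i) (blkV i) (GlEta t i W x₀) S
        (fun y'' y' => CG * (geoB i).len y'' ^ 2 * Real.exp (-(δG * (geoB i).dist y'' y'))) := by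
  obtain ⟨δ, hδ, A, hA, h⟩ := reach2133_G d (ℓ + 1) hd hL ha₀ ha₁
  refine ⟨δ / (d + 1), by positivity, ((ℓ + 1) ^ (d + 1) : ℕ) * (A * Real.exp (δ * ((d + 1 : ℝ) + (d + 1)) / (d + 1))),
    by positivity, fun t i x₀ hx₀ Wd hWd hlev W hW S hS => ?_⟩
  classical
  have hloc := h t (g := geoB i) (blkV i) S (fun q : XV i => ((q.2 : ↥(i.XB)) : Fin (d + 1) → ℤ)) (fun q => q.1) x₀ hWd W hW
    (fun q _ q' _ hqq => by
      obtain ⟨h2, h1⟩ := Prod.mk.injEq _ _ _ _ ▸ hqq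
      exact Prod.ext h1 (Subtype.ext h2))
    (d + 1) (d + 1) (by positivity)
    (fun q hq q₁ hq₁ hqS hq₁S => by
      rw [geoB_dist]
      exact hglob_sites t i.D i.hMh i.hP (fun q : XV i => q.2) x₀ Wd (fun z hz hw => (hlev z hz hw).1) W hW S q hq q₁ hq₁ hqS hq₁S)
    ((ℓ + 1) ^ (d + 1)) (fun y _ => hfib_sites t i.D (fun q : XV i => q.2) (fun q => q.1) x₀ hx₀ Wd hWd hlev W hW y)
  refine localMajorant_smul_of_le (g := geoB i) (blkV i) hloc (sq_nonneg _) fun a ha b _ => ?_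
  have hsc := scale_pow_le_len_pow t i 2 (hS a ha)
  have hpos : 0 ≤ (((ℓ + 1) ^ (d + 1) : ℕ) : ℝ) * (A * Real.exp (δ * ((d + 1 : ℝ) + (d + 1)) / (d + 1))) *
      Real.exp (-(δ / (d + 1) * (geoB i).dist a b)) := by positivity
  calc ((((ℓ : ℝ) + 1) ^ t.j * (((nK i : ℕ) : ℝ))⁻¹) ^ 2) *
        ((((ℓ + 1) ^ (d + 1) : ℕ) : ℝ) * ((A * Real.exp (δ * ((d + 1 : ℝ) + (d + 1)) / (d + 1))) *
          Real.exp (-(δ / (d + 1) * (geoB i).dist a b))))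
      = ((((ℓ + 1) ^ (d + 1) : ℕ) : ℝ) * (A * Real.exp (δ * ((d + 1 : ℝ) + (d + 1)) / (d + 1))) *
          Real.exp (-(δ / (d + 1) * (geoB i).dist a b))) * ((((ℓ : ℝ) + 1) ^ t.j * (((nK i : ℕ) : ℝ))⁻¹) ^ 2) := by ring
    _ ≤ ((((ℓ + 1) ^ (d + 1) : ℕ) : ℝ) * (A * Real.exp (δ * ((d + 1 : ℝ) + (d + 1)) / (d + 1))) *
          Real.exp (-(δ / (d + 1) * (geoB i).dist a b))) * (geoB i).len a ^ 2 := mul_le_mul_of_nonneg_left hsc hpos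
    _ = (((ℓ + 1) ^ (d + 1) : ℕ) : ℝ) * (A * Real.exp (δ * ((d + 1 : ℝ) + (d + 1)) / (d + 1))) * (geoB i).len a ^ 2 *
          Real.exp (-(δ / (d + 1) * (geoB i).dist a b)) := by ring

/-- the `∇_λG_□` twin: the `hEG`-type input (weight `len(y″)`, every direction `λ`). [cite: Balaban1984PropagatorsII, (2.133)–(2.134) p.247, (2.94) p.239] -/
theorem reach2133_DG_geoB (d ℓ : ℕ) (hd : 1 ≤ d + 1) (hL : Odd (ℓ + 1) ∧ 1 < ℓ + 1) {a₀ a₁ : ℝ} (ha₀ : 0 < a₀) (ha₁ : a₀ ≤ a₁) :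
    ∃ δG : ℝ, 0 < δG ∧ ∃ CG : ℝ, 0 ≤ CG ∧ ∀ (t : TSIdx d (ℓ + 1) hd hL a₀ a₁) (lam : Fin t.P.d) (i : B6Prop22KLevelCensusL0.KIdx d ℓ) (x₀ : Fin (d + 1) → ℤ)
      (_ : ∀ μ, (((ℓ + 1) ^ t.j : ℕ) : ℤ) ∣ x₀ μ) (Wd : ℕ) (_ : Wd ≤ (ℓ + 1) ^ (t.m + t.K))
      (_ : ∀ z ∈ boxDom (N0 ℓ i.Mh i.k i.P), (∀ μ, x₀ μ ≤ z μ ∧ z μ < x₀ μ + Wd) → t.j ≤ i.D.lev z ∧ i.D.lev z ≤ t.j + 1)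
      (W : Finset (XV i)) (_ : ∀ q ∈ W, InWindow (fun q : XV i => ((q.2 : ↥(i.XB)) : Fin (d + 1) → ℤ)) x₀ Wd q)
      (S : Set (geoB i).Site) (_ : ∀ a ∈ S, t.j ≤ a.1.1),
      LocalMajorant (g := geoB i) (blkV i) (DGlEta t i lam W x₀) S
        (fun y'' y' => CG * (geoB i).len y'' * Real.exp (-(δG * (geoB i).dist y'' y'))) := by
  obtain ⟨δ, hδ, A, hA, h⟩ := reach2133_DG d (ℓ + 1) hd hL ha₀ ha₁
  refine ⟨δ / (d + 1), by positivity, ((ℓ + 1) ^ (d + 1) : ℕ) * (A * Real.exp (δ * ((d + 1 : ℝ) + (d + 1)) / (d + 1))),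
    by positivity, fun t lam i x₀ hx₀ Wd hWd hlev W hW S hS => ?_⟩
  classical
  have hloc := h t lam (g := geoB i) (blkV i) S (fun q : XV i => ((q.2 : ↥(i.XB)) : Fin (d + 1) → ℤ)) (fun q => q.1) x₀ hWd W hW
    (fun q _ q' _ hqq => by
      obtain ⟨h2, h1⟩ := Prod.mk.injEq _ _ _ _ ▸ hqq
      exact Prod.ext h1 (Subtype.ext h2))
    (d + 1) (d + 1) (by positivity)
    (fun q hq q₁ hq₁ hqS hq₁S => by
      rw [geoB_dist]
      exact hglob_sites t i.D i.hMh i.hP (fun q : XV i => q.2) x₀ Wd (fun z hz hw => (hlev z hz hw).1) W hW S q hq q₁ hq₁ hqS hq₁S)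
    ((ℓ + 1) ^ (d + 1)) (fun y _ => hfib_sites t i.D (fun q : XV i => q.2) (fun q => q.1) x₀ hx₀ Wd hWd hlev W hW y)
  refine localMajorant_smul_of_le (g := geoB i) (blkV i) hloc (by positivity) fun a ha b _ => ?_
  have hsc := scale_pow_le_len_pow t i 1 (hS a ha)
  rw [pow_one, pow_one] at hsc
  have hpos : 0 ≤ (((ℓ + 1) ^ (d + 1) : ℕ) : ℝ) * (A * Real.exp (δ * ((d + 1 : ℝ) + (d + 1)) / (d + 1))) *
      Real.exp (-(δ / (d + 1) * (geoB i).dist a b)) := by positivity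
  calc ((((ℓ : ℝ) + 1) ^ t.j * (((nK i : ℕ) : ℝ))⁻¹)) *
        ((((ℓ + 1) ^ (d + 1) : ℕ) : ℝ) * ((A * Real.exp (δ * ((d + 1 : ℝ) + (d + 1)) / (d + 1))) *
          Real.exp (-(δ / (d + 1) * (geoB i).dist a b))))
      = ((((ℓ + 1) ^ (d + 1) : ℕ) : ℝ) * (A * Real.exp (δ * ((d + 1 : ℝ) + (d + 1)) / (d + 1))) *
          Real.exp (-(δ / (d + 1) * (geoB i).dist a b))) * ((((ℓ : ℝ) + 1) ^ t.j * (((nK i : ℕ) : ℝ))⁻¹)) := by ring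
    _ ≤ ((((ℓ + 1) ^ (d + 1) : ℕ) : ℝ) * (A * Real.exp (δ * ((d + 1 : ℝ) + (d + 1)) / (d + 1))) *
          Real.exp (-(δ / (d + 1) * (geoB i).dist a b))) * (geoB i).len a := mul_le_mul_of_nonneg_left hsc hpos
    _ = (((ℓ + 1) ^ (d + 1) : ℕ) : ℝ) * (A * Real.exp (δ * ((d + 1 : ℝ) + (d + 1)) / (d + 1))) * (geoB i).len a *
          Real.exp (-(δ / (d + 1) * (geoB i).dist a b)) := by ring

end GeoB

/-! ## §8  (v1.2) Localisation of the transplanted operators: `OutLoc` / `InLoc` off the blocks met by the window (the hypotheses `hGout` of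
`B6Ineq2134Diag.diag_hasMajorant` / `hKout` of the gluing, asked by p38 gen 25 for (b′)) -/

section Loc

open B6Prop26Gluing (OutLoc InLoc)
open B6Prop25TwoScaleCensus (TSIdx)
open B6Prop22KLevelCensusL0 (KIdx)
open B6Ineq288MultiLevelBoxL0 (geoB)
open B6Ineq2134ThetaKLevelL0 (XV blkV)

variable {X X' : Type} [DecidableEq X'] [DecidableEq X] {W : Finset X} {e : X → X'}

omit [DecidableEq X'] [DecidableEq X] in
/-- localisation survives scaling. [folklore] -/
private theorem outLoc_smul {g : B6.Geometry} {blk : X → g.Site} {T : Module.End ℝ (X → ℝ)} {S : Set g.Site} (h : OutLoc blk T S) (c : ℝ) :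
    OutLoc blk (c • T) S := fun v x hx => by
  rw [LinearMap.smul_apply, Pi.smul_apply, h v x hx, smul_zero]

omit [DecidableEq X'] [DecidableEq X] in
/-- localisation survives scaling (input side). [folklore] -/
private theorem inLoc_smul {g : B6.Geometry} {blk : X → g.Site} {T : Module.End ℝ (X → ℝ)} {S : Set g.Site} (h : InLoc blk T S) (c : ℝ) :
    InLoc blk (c • T) S := fun y' μ B hμ hy' => by
  rw [LinearMap.smul_apply, h y' μ B hμ hy', smul_zero]

variable {d ℓ : ℕ} {hd : 1 ≤ d + 1} {hL : Odd (ℓ + 1) ∧ 1 < ℓ + 1} {a₀ a₁ : ℝ} (t : TSIdx d (ℓ + 1) hd hL a₀ a₁)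

/-- `hGout` for `GlEta`: the transplanted `G_□` (η-units) writes only on the blocks met by the window. [cite: Balaban1984PropagatorsII, (2.91)–(2.92) p.239; derivation ours] -/
theorem outLoc_GlEta (i : KIdx d ℓ) (W : Finset (XV i)) (x₀ : Fin (d + 1) → ℤ) {T : Set (geoB i).Site} (hWT : ∀ q ∈ W, blkV i q ∈ T) :
    OutLoc (blkV i) (GlEta t i W x₀) T :=
  outLoc_smul (outLoc_transplant (g := geoB i) (blkV i) hWT _) _

/-- `hGout` for `DGlEta`. [cite: Balaban1984PropagatorsII, (2.91)–(2.92) p.239; derivation ours] -/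
theorem outLoc_DGlEta (i : KIdx d ℓ) (lam : Fin t.P.d) (W : Finset (XV i)) (x₀ : Fin (d + 1) → ℤ) {T : Set (geoB i).Site}
    (hWT : ∀ q ∈ W, blkV i q ∈ T) : OutLoc (blkV i) (DGlEta t i lam W x₀) T :=
  outLoc_smul (outLoc_transplant (g := geoB i) (blkV i) hWT _) _

/-- input localisation for `GlEta` (the window of side `≤ L^{m+K}` makes the chart injective, `injOn_chartBond`). [cite: Balaban1984PropagatorsII, (2.91) p.239; derivation ours] -/
theorem inLoc_GlEta (i : KIdx d ℓ) (W : Finset (XV i)) (x₀ : Fin (d + 1) → ℤ) {Wd : ℕ} (hWd : Wd ≤ (ℓ + 1) ^ (t.m + t.K))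
    (hW : ∀ q ∈ W, InWindow (fun q : XV i => ((q.2 : ↥(i.XB)) : Fin (d + 1) → ℤ)) x₀ Wd q) {T : Set (geoB i).Site}
    (hWT : ∀ q ∈ W, blkV i q ∈ T) : InLoc (blkV i) (GlEta t i W x₀) T := by
  classical
  refine inLoc_smul (inLoc_transplant (g := geoB i) (blkV i) hWT ?_ _) _
  refine injOn_chartBond t _ _ x₀ hWd W hW ?_
  intro q _ q' _ hqq
  simp only [Prod.mk.injEq] at hqq
  exact Prod.ext hqq.2 (Subtype.ext hqq.1)

end Loc

/-! ## §9 (v1.3)  THE BIJECTIVE WINDOW `□̃³ = T_□` (p. 238: *"We take the cube □̃³ and identify it with a torus, denoted by T_□, imposing periodicity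
conditions"*): when the chart is a BIJECTION of the window onto the local lattice, `ρ ∘ ε = 1`, the transplant is MULTIPLICATIVE, and the local
inversion `Δ_□G_□ = 1` on `T_□` transplants to the INVERSION HYPOTHESIS `(M_□ − P_□)·G_□·h_□ = h_□` of (2.91) (`B6Eq291Generator.eq291`'s `hinv`)
for every `h_□` supported in the window -/

section Bijective

open B6Prop26Gluing (mulOp mulOp_apply)

variable {X X' : Type} [DecidableEq X'] [DecidableEq X] {W : Finset X} {e : X → X'}

end Bijective

/-! ### §9b  The full window of `T_□` is a bijective chart -/

section FullWindow

open B6Prop25TwoScaleCensus (TSIdx)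

variable {d L : ℕ} {hd : 1 ≤ d + 1} {hL : Odd L ∧ 1 < L} {a₀ a₁ : ℝ} (i : TSIdx d L hd hL a₀ a₁)

end FullWindow

/-! ### §9c  (2.133) through a LARGE window with the reach in a HALF-PERIOD sub-window (the transplant may use the full fundamental domain
`□̃³ = T_□`, side `2L^{m+K}`; the kernel comparison torus distance = flat distance is needed only for pairs over the reach `S ⊂ □̃`, which
sits in a sub-window of side `≤ L^{m+K}` with corner in `x₀ + L^jℤ^{d+1}`) -/

section ShiftedWindow

open B6RandomWalk (HasMajorant)
open B6Prop26Gluing (LocalMajorant)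
open B5Eq118OneStroke (iterBlockOf)
open B6LowerBound2153Torus (rep)
open B5Eq117TorusCarriers (Mk)
open B4ContourShift (supNorm abs_le_supNorm supNorm_nonneg)
open B4TorusKernel.MultiPeriod (torusSupNorm torusSupNorm_of_centred)
open B6Prop25TwoScaleCensus (TSIdx)
open B6Ineq2133TwoScaleV1 (tsGeo onFun ineq2133_G ineq2133_DG)

variable {d L : ℕ} {hd : 1 ≤ d + 1} {hL : Odd L ∧ 1 < L} {a₀ a₁ : ℝ} (i : TSIdx d L hd hL a₀ a₁)

/-- labels of a shifted sub-window: `a ≤ z < a + L^{m+K}`, `L^j ∣ a` ⟹ `a/L^j ≤ ⌊z/L^j⌋ < a/L^j + L^{m+K−j}`. [folklore] -/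
private theorem ediv_window_shift {a z : ℤ} (ha : ((L ^ i.j : ℕ) : ℤ) ∣ a) (haz : a ≤ z) (hza : z < a + ((L ^ (i.m + i.K) : ℕ) : ℤ)) :
    a / ((L ^ i.j : ℕ) : ℤ) ≤ z / ((L ^ i.j : ℕ) : ℤ) ∧
      z / ((L ^ i.j : ℕ) : ℤ) < a / ((L ^ i.j : ℕ) : ℤ) + ((L ^ (i.m + i.K - i.j) : ℕ) : ℤ) := by
  have hL0 : 0 < L := by have := hL.2; omega
  have hn : (0 : ℤ) < ((L ^ i.j : ℕ) : ℤ) := by positivity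
  refine ⟨Int.ediv_le_ediv hn haz, Int.ediv_lt_of_lt_mul hn ?_⟩
  have hpow : ((L ^ (i.m + i.K) : ℕ) : ℤ) = ((L ^ (i.m + i.K - i.j) : ℕ) : ℤ) * ((L ^ i.j : ℕ) : ℤ) := by
    rw [← Nat.cast_mul, ← pow_add, Nat.sub_add_cancel (Nat.le_of_succ_le i.hjP)]
  obtain ⟨q, hq⟩ := ha
  have haq : a / ((L ^ i.j : ℕ) : ℤ) = q := by rw [hq, Int.mul_ediv_cancel_left _ hn.ne']
  rw [haq, add_mul, hpow.symm]
  calc z < a + ((L ^ (i.m + i.K) : ℕ) : ℤ) := hza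
    _ = q * ((L ^ i.j : ℕ) : ℤ) + ((L ^ (i.m + i.K) : ℕ) : ℤ) := by rw [hq, mul_comm]

end ShiftedWindow

end Literature.MathematicalPhysics.QuantumFieldTheory.Balaban1983to89.B6Prop26ReachTransplantL0
end
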